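import Summits.QuantumFields.BalabanUV.Beta.GAN24.FibreRateTBlock

/-!
# `BalabanUV.Beta.GAN24.FibreRateFeedTerms` — binder row G-an2-4 / (CONV-C), road P1-fibre, self-row **P1-Y11t\*** (alias-sum side of p1 row
# L11, division agreed with the L11 owner in CLAIMS l.3039/l.3094), part 6: the READING-SIDE sums `R_φ, R_c` and the SOURCE-SIDE sums
# `S_φ, S_c` of the capacitance-feed share — summands, links to T00, and EXACT FACTORISATIONS at real momentum

NOT IN PRINT; OUR PROOF ATTEMPT.  HONEST FRAMING (cell contract, verbatim): «discharging `BetaPertH` makes Bałaban's UV stability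
UNCONDITIONAL — a real constructive-QFT result; it is NOT the continuum limit and NOT the Clay problem.»  HONEST DEPENDENCY (verbatim):
«continuum YM on T⁴ ⇐ BetaPertH ∧ nine spine estimates (0/9 proved); BetaPertH ⇐ (D1) ∧ (D4) ∧ CAP+tail; G-an2-4 gates asym, D1 and
NE2/3/4.»  [folklore] exact finite algebra over the DEFINITIONS of typer row T00 `GAN24/AliasObjects` (`readW srcW chiAl sAl sbAl SAl SbMAl
sMAl sbMAl dAl dbAl LAl srcPhi srcC fhatF piPerp gs`), `FibreBlockSolve.Asol/dot`, part 1 `FibreRateTBlock` (`qlab`, `sMAl_mul_dAl`,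
`sbMAl_mul_dbAl`, `kSym_ofRealVec_apply`, `dAl/dbAl_ofRealVec`) and row Y11d `AliasReindex` (`kSym` dictionary) BY NAME; six harmless data `def`s
(`rPhiTerm rCTerm sPhiTerm sCTerm` = the four summands, `mfac mfacS` = the mixed-level reading factors); NO estimate, NO cited fact, NO
`def … : Prop`, NO wall binder, NO unit re-typed.  NOT summit progress; nothing of (CONV-C)'s K-slot is discharged here.

## The L11 owner's structure (CLAIMS l.3039, verbatim shape): `Â(m) = Asol(f̂_m, 0) + Asol(FEED_m, χ̂_m c)`, `FEED_m = χ̂_m·s♭(m) ⊙ φ`, so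
## `readW·Asol(FEED_m, χ̂_m c)_κ = Σ_{l′} R_φ-summand(m; κ, l′)·φ_{l′} + R_c-summand(m; κ)·c` and `(r_φ, r_c) = (Σ_m S_φ-summand, Σ_m S_c-summand)`.
* §1 SUMMANDS + LINKS: `rPhiTerm`, `rCTerm` with **`readW_mul_Asol_feed`**; `sPhiTerm`, `sCTerm` with **`srcPhi_fhatF_eq_sum`**, **`srcC_fhatF_eq_sum`**
  (T00's `srcPhi/srcC` sum over the regular set `reg N p`; the summands vanish off it under `x/0 = 0`, so the sums run over ALL classes).
* §2 AT REAL MOMENTUM `pr`, `N = M·Lc`, label `q = qlab pr m`: the telescoping identities `s_{N,κ}(m)·∂_{mκ} = e^{iq_κ} − 1`, `s♭_{N,l}(m)·∂♭_{ml} = e^{−iq_l} − 1`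
  (`sAl_mul_dAl`, `sbAl_mul_dbAl` — level- AND (mod 2π) label-free) and the MIXED-LEVEL reading factors
  `mfac N M q := gs(q/N, M)·gs(−q/N, N)/N²` (`= s_{M,i}s♭_{N,i}/N²`), `mfacS N M q := gs(q/N, N)·gs(−q/N, M)/N²` (`= s_{N,i}s♭_{M,i}/N²`), with
  `S_M S♭_N = N^{2D}·Π_i mfac`, `S_N S♭_M = N^{2D}·Π_i mfacS`; the reading phase `e^{i q·x′/Lc}` and the source phase `e^{−i q·y′/Lc}`.
* §3 **FACTORISATIONS** (unit `u = M^{D+1}/N^{D+4}` for all four; `ℓ = latticeSymbol N⁻¹ 0 q`):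
  `M^{D+1}·rPhiTerm = N^{D+4}·e^{iq·x′/Lc}·(Π mfac)·([κ=l′]·mfac(q_κ)/(2ℓ) − (e^{iq_κ/Lc} − 1)(e^{−iq_{l′}} − 1)/(2ℓ²))`,
  `M^{D+1}·rCTerm = N^{D+4}·e^{iq·x′/Lc}·(Π mfac)·(e^{iq_κ/Lc} − 1)/ℓ²`,
  `M^{D+1}·sPhiTerm = −N^{D+4}·e^{−iq·y′/Lc}·(Π mfacS)·([l′=l]·mfacS(q_l)/(2ℓ) − (e^{iq_{l′}} − 1)(e^{−iq_l/Lc} − 1)/(2ℓ²))`,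
  `M^{D+1}·sCTerm = −N^{D+4}·e^{−iq·y′/Lc}·(Π mfacS)·(e^{−iq_l/Lc} − 1)/ℓ²`
  — all four are `phase × Π_i(factor) × xGen`-shaped (part 5's engine); the `p`-orders sit in the numerators (`|e^{ix} − 1| ≤ |x|`).
Consumers: part 7 `GAN24/FibreRateFeedSums` (bounds + two-level rates of the four normalised sums), p1 row L11 `FibreRate` (leaf-20-g7).
-/

noncomputable section

open Complex Finset
open scoped BigOperators Real ComplexConjugate
open Literature.Probability.LatticeModels (TorusSite)
open Literature.MathematicalPhysics.QuantumFieldTheory.King1986 (latticeSymbol)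
open Literature.MathematicalPhysics.QuantumFieldTheory.Balaban1983to89.B4Strip (ofRealVec)
open Summit.QuantumFields.BalabanUV.Beta.GAN24.FibreBlockSolve (dot Asol)
open Summit.QuantumFields.BalabanUV.Beta.GAN24.AliasObjects
  (kAl gs sAl SAl sbAl SbAl chiAl dAl dbAl LAl sMAl SMAl sbMAl SbMAl readW srcW fhatF srcPhi srcC piPerp reg mem_reg)
open Summit.QuantumFields.BalabanUV.Beta.GAN24.AliasReindex (kSym sAl_eq_kSym sbAl_eq_kSym sMAl_eq_kSym sbMAl_eq_kSym readPhase_eq_kSym srcPhase_eq_kSym)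
open Summit.QuantumFields.BalabanUV.Beta.GAN24.FibreRateTBlock
  (qlab kSym_ofRealVec_apply dAl_ofRealVec dbAl_ofRealVec sMAl_mul_dAl sbMAl_mul_dbAl LAl_ofRealVec_eq dot_dbAl_fhatF)

namespace Summit.QuantumFields.BalabanUV.Beta.GAN24.FibreRateFeedTerms

variable {D : ℕ}

/-! ## §1 The four summands and their links to T00 -/

section Terms

variable (N M : ℕ) [NeZero N] (p : Fin D → ℂ)

/-- [folklore] READING-SIDE `φ`-summand `R_φ(m; κ, l′; x′) = readW(m,κ,x′)·χ̂_m·(δ_{κl′} − ∂_{mκ}∂♭_{ml′}/L_m)·s♭_{l′}(m)/(2L_m)`. -/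
def rPhiTerm (m : TorusSite D N) (κ l' : Fin D) (x' : Fin D → ℤ) : ℂ :=
  readW N M p m κ x' * chiAl N p m *
    (((if κ = l' then 1 else 0) - dAl N p m κ * dbAl N p m l' / LAl N p m) * sbAl N p m l' / (2 * LAl N p m))

/-- [folklore] READING-SIDE `c`-summand `R_c(m; κ; x′) = readW(m,κ,x′)·χ̂_m·∂_{mκ}/L_m²`. -/
def rCTerm (m : TorusSite D N) (κ : Fin D) (x' : Fin D → ℤ) : ℂ :=
  readW N M p m κ x' * chiAl N p m * dAl N p m κ / LAl N p m ^ 2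

/-- [folklore] SOURCE-SIDE `φ`-summand `S_φ(m; l′; l, y′) = −S(m)/(2L_m)·s_{l′}(m)·srcW(m,l,y′)·(δ_{l′l} − ∂_{ml′}∂♭_{ml}/L_m)`. -/
def sPhiTerm (m : TorusSite D N) (l' l : Fin D) (y' : Fin D → ℤ) : ℂ :=
  -(SAl N p m / (2 * LAl N p m) * sAl N p m l' *
    (srcW N M p m l y' * ((if l' = l then 1 else 0) - dAl N p m l' * dbAl N p m l / LAl N p m)))

/-- [folklore] SOURCE-SIDE `c`-summand `S_c(m; l, y′) = −S(m)·∂♭_{ml}·srcW(m,l,y′)/L_m²`. -/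
def sCTerm (m : TorusSite D N) (l : Fin D) (y' : Fin D → ℤ) : ℂ :=
  -(SAl N p m * (dbAl N p m l * srcW N M p m l y') / LAl N p m ^ 2)

/-- [folklore] **THE FEED RESPONSE READ BY A FIELD LEG**: `readW·Asol(∂_m, ∂♭_m, χ̂_m s♭(m) ⊙ φ, L_m, χ̂_m c)_κ = Σ_{l′} R_φ(m;κ,l′)·φ_{l′} + R_c(m;κ)·c`. -/
theorem readW_mul_Asol_feed (m : TorusSite D N) (κ : Fin D) (x' : Fin D → ℤ) (φ : Fin D → ℂ) (c : ℂ) :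
    readW N M p m κ x' * Asol (dAl N p m) (dbAl N p m) (fun l' => chiAl N p m * sbAl N p m l' * φ l') (LAl N p m) (chiAl N p m * c) κ =
      ∑ l', rPhiTerm N M p m κ l' x' * φ l' + rCTerm N M p m κ x' * c := by
  unfold rPhiTerm rCTerm Asol dot
  have e : ∀ l', readW N M p m κ x' * chiAl N p m *
      (((if κ = l' then 1 else 0) - dAl N p m κ * dbAl N p m l' / LAl N p m) * sbAl N p m l' / (2 * LAl N p m)) * φ l' =
      readW N M p m κ x' * ((if κ = l' then chiAl N p m * sbAl N p m l' * φ l' else 0) / (2 * LAl N p m)) -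
        readW N M p m κ x' * (dAl N p m κ * (dbAl N p m l' * (chiAl N p m * sbAl N p m l' * φ l')) / LAl N p m / (2 * LAl N p m)) := by
    intro l'; split_ifs <;> ring
  rw [Finset.sum_congr rfl fun l' _ => e l', Finset.sum_sub_distrib, ← Finset.mul_sum, ← Finset.mul_sum, ← Finset.sum_div,
    Finset.sum_ite_eq Finset.univ κ, if_pos (Finset.mem_univ κ), ← Finset.sum_div, ← Finset.sum_div, ← Finset.mul_sum]
  ring

/-- [folklore] Off the regular set every `L_m`-denominated summand vanishes (`x/0 = 0`): sums over `reg N p` are sums over all classes. -/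
theorem sum_reg_eq_sum {f : TorusSite D N → ℂ} (hf : ∀ m, LAl N p m = 0 → f m = 0) : ∑ m ∈ reg N p, f m = ∑ m, f m := by
  classical
  refine Finset.sum_subset (Finset.subset_univ _) fun m _ hm => ?_
  exact hf m (by by_contra h; exact hm ((mem_reg N p m).2 h))

/-- [folklore] **`r_φ` OF A FORCE SOURCE IS THE SUM OF THE `S_φ`-SUMMANDS**: `srcPhi N p (fhatF N M p l y′) 0 l′ = Σ_m S_φ(m; l′; l, y′)`. -/
theorem srcPhi_fhatF_eq_sum (l' l : Fin D) (y' : Fin D → ℤ) :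
    srcPhi N p (fhatF N M p l y') 0 l' = ∑ m, sPhiTerm N M p m l' l y' := by
  unfold srcPhi
  rw [Pi.zero_apply, zero_sub, ← Finset.sum_neg_distrib]
  have e : ∀ m, -(SAl N p m / (2 * LAl N p m) * sAl N p m l' * piPerp (dAl N p m) (dbAl N p m) (LAl N p m) (fhatF N M p l y' m) l') =
      sPhiTerm N M p m l' l y' := by
    intro m
    unfold sPhiTerm piPerp
    rw [dot_dbAl_fhatF]
    unfold fhatF
    split_ifs <;> ring
  rw [Finset.sum_congr rfl fun m _ => e m]
  exact sum_reg_eq_sum N p fun m h => by unfold sPhiTerm; rw [h]; simp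

/-- [folklore] **`r_c` OF A FORCE SOURCE IS THE SUM OF THE `S_c`-SUMMANDS**: `srcC N p (fhatF N M p l y′) = Σ_m S_c(m; l, y′)`. -/
theorem srcC_fhatF_eq_sum (l : Fin D) (y' : Fin D → ℤ) : srcC N p (fhatF N M p l y') = ∑ m, sCTerm N M p m l y' := by
  unfold srcC
  rw [← Finset.sum_neg_distrib]
  have e : ∀ m, -(SAl N p m * dot (dbAl N p m) (fhatF N M p l y' m) / LAl N p m ^ 2) = sCTerm N M p m l y' := by
    intro m; unfold sCTerm; rw [dot_dbAl_fhatF]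
  rw [Finset.sum_congr rfl fun m _ => e m]
  exact sum_reg_eq_sum N p fun m h => by unfold sCTerm; rw [h]; simp

end Terms

/-! ## §2 Real momentum: the `N`-level telescoping identities, the mixed reading factors, the phases -/

section Real

variable {N : ℕ} [NeZero N]

/-- [folklore] **`s_{N,κ}(m)·∂_{mκ} = e^{iq_κ} − 1`** (`G(z,N)(e^{iz} − 1) = e^{izN} − 1` at `z = q_κ/N`): level-free. -/
theorem sAl_mul_dAl (pr : Fin D → ℝ) (m : TorusSite D N) (κ : Fin D) :
    sAl N (ofRealVec pr) m κ * dAl N (ofRealVec pr) m κ = cexp (I * ((qlab pr m κ : ℝ) : ℂ)) - 1 := by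
  rw [sAl_eq_kSym, kSym_ofRealVec_apply, dAl_ofRealVec, gs, AliasWeights.geomExp_mul_sub_one]
  congr 2
  have hN : (N : ℂ) ≠ 0 := Nat.cast_ne_zero.2 (NeZero.ne N)
  push_cast; field_simp

/-- [folklore] **`s♭_{N,l}(m)·∂♭_{ml} = e^{−iq_l} − 1`**: level-free. -/
theorem sbAl_mul_dbAl (pr : Fin D → ℝ) (m : TorusSite D N) (l : Fin D) :
    sbAl N (ofRealVec pr) m l * dbAl N (ofRealVec pr) m l = cexp (-(I * ((qlab pr m l : ℝ) : ℂ))) - 1 := by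
  rw [sbAl_eq_kSym, kSym_ofRealVec_apply, dbAl_ofRealVec]
  have e1 : -(I * (((qlab pr m l / N : ℝ) : ℂ))) = I * (-(((qlab pr m l / N : ℝ) : ℂ))) := by ring
  rw [gs, e1, AliasWeights.geomExp_mul_sub_one]
  congr 2
  have hN : (N : ℂ) ≠ 0 := Nat.cast_ne_zero.2 (NeZero.ne N)
  push_cast; field_simp

/-- [folklore] MIXED-LEVEL reading factor `mfac N M q = gs(q/N, M)·gs(−q/N, N)/N²` (`= s_{M,i}(m)·s♭_{N,i}(m)/N²` at the label `q`). -/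
def mfac (N M : ℕ) (q : ℝ) : ℂ := gs ((q / N : ℝ) : ℂ) M * gs (-((q / N : ℝ) : ℂ)) N / (N : ℂ) ^ 2

/-- [folklore] Its mirror `mfacS N M q = gs(q/N, N)·gs(−q/N, M)/N²` (`= s_{N,i}(m)·s♭_{M,i}(m)/N²`). -/
def mfacS (N M : ℕ) (q : ℝ) : ℂ := gs ((q / N : ℝ) : ℂ) N * gs (-((q / N : ℝ) : ℂ)) M / (N : ℂ) ^ 2

/-- [folklore] `s_{M,i}(m)·s♭_{N,i}(m) = N²·mfac N M q_i`. -/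
theorem sMAl_mul_sbAl (M : ℕ) (pr : Fin D → ℝ) (m : TorusSite D N) (i : Fin D) :
    sMAl N M (ofRealVec pr) m i * sbAl N (ofRealVec pr) m i = (N : ℂ) ^ 2 * mfac N M (qlab pr m i) := by
  have hN : (N : ℂ) ≠ 0 := Nat.cast_ne_zero.2 (NeZero.ne N)
  rw [sMAl_eq_kSym, sbAl_eq_kSym, kSym_ofRealVec_apply, mfac]
  field_simp

/-- [folklore] `s_{N,i}(m)·s♭_{M,i}(m) = N²·mfacS N M q_i`. -/
theorem sAl_mul_sbMAl (M : ℕ) (pr : Fin D → ℝ) (m : TorusSite D N) (i : Fin D) :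
    sAl N (ofRealVec pr) m i * sbMAl N M (ofRealVec pr) m i = (N : ℂ) ^ 2 * mfacS N M (qlab pr m i) := by
  have hN : (N : ℂ) ≠ 0 := Nat.cast_ne_zero.2 (NeZero.ne N)
  rw [sAl_eq_kSym, sbMAl_eq_kSym, kSym_ofRealVec_apply, mfacS]
  field_simp

/-- [folklore] `S_M(m)·S♭(m) = N^{2D}·Π_i mfac N M q_i`. -/
theorem SMAl_mul_SbAl (M : ℕ) (pr : Fin D → ℝ) (m : TorusSite D N) :
    SMAl N M (ofRealVec pr) m * SbAl N (ofRealVec pr) m = ((N : ℂ) ^ 2) ^ D * ∏ i, mfac N M (qlab pr m i) := by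
  unfold SMAl SbAl
  rw [← Finset.prod_mul_distrib, Finset.prod_congr rfl fun i _ => sMAl_mul_sbAl M pr m i, Finset.prod_mul_distrib, Finset.prod_const,
    Finset.card_univ, Fintype.card_fin]

/-- [folklore] `S(m)·S♭_M(m) = N^{2D}·Π_i mfacS N M q_i`. -/
theorem SAl_mul_SbMAl (M : ℕ) (pr : Fin D → ℝ) (m : TorusSite D N) :
    SAl N (ofRealVec pr) m * SbMAl N M (ofRealVec pr) m = ((N : ℂ) ^ 2) ^ D * ∏ i, mfacS N M (qlab pr m i) := by
  unfold SAl SbMAl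
  rw [← Finset.prod_mul_distrib, Finset.prod_congr rfl fun i _ => sAl_mul_sbMAl M pr m i, Finset.prod_mul_distrib, Finset.prod_const,
    Finset.card_univ, Fintype.card_fin]

/-- [folklore] THE READING PHASE ALONE is level-free: `e^{i Σ kAl_i·(M x′_i)} = e^{i Σ (q_i/Lc)·x′_i}` (`N = M·Lc`). -/
theorem readPhase_eq {M Lc : ℕ} (hLc : Lc ≠ 0) (hNM : N = M * Lc) (pr : Fin D → ℝ) (m : TorusSite D N) (x' : Fin D → ℤ) :
    cexp (I * ∑ i, kAl N (ofRealVec pr) m i * ((M : ℂ) * (x' i : ℂ))) = cexp (I * ∑ i, ((qlab pr m i / Lc : ℝ) : ℂ) * (x' i : ℂ)) := by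
  rw [readPhase_eq_kSym]
  congr 2
  refine Finset.sum_congr rfl fun i _ => ?_
  have hLc' : (Lc : ℂ) ≠ 0 := Nat.cast_ne_zero.2 hLc
  have hNLc : (N : ℂ) = (M : ℂ) * Lc := by rw [hNM]; push_cast; ring
  have hM' : (M : ℂ) ≠ 0 := by
    rintro hM0
    exact (Nat.cast_ne_zero.2 (NeZero.ne N)) (by rw [hNLc, hM0, zero_mul])
  rw [kSym_ofRealVec_apply]; push_cast; rw [hNLc]; field_simp

/-- [folklore] THE SOURCE PHASE ALONE is level-free: `e^{−i Σ kAl_i·(M y′_i)} = e^{−i Σ (q_i/Lc)·y′_i}` (`N = M·Lc`). -/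
theorem srcPhase_eq {M Lc : ℕ} (hLc : Lc ≠ 0) (hNM : N = M * Lc) (pr : Fin D → ℝ) (m : TorusSite D N) (y' : Fin D → ℤ) :
    cexp (-(I * ∑ i, kAl N (ofRealVec pr) m i * ((M : ℂ) * (y' i : ℂ)))) = cexp (-(I * ∑ i, ((qlab pr m i / Lc : ℝ) : ℂ) * (y' i : ℂ))) := by
  rw [srcPhase_eq_kSym]
  congr 3
  refine Finset.sum_congr rfl fun i _ => ?_
  have hLc' : (Lc : ℂ) ≠ 0 := Nat.cast_ne_zero.2 hLc
  have hNLc : (N : ℂ) = (M : ℂ) * Lc := by rw [hNM]; push_cast; ring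
  have hM' : (M : ℂ) ≠ 0 := by
    rintro hM0
    exact (Nat.cast_ne_zero.2 (NeZero.ne N)) (by rw [hNLc, hM0, zero_mul])
  rw [kSym_ofRealVec_apply]; push_cast; rw [hNLc]; field_simp

/-! ## §3 The factorisations -/

variable {M Lc : ℕ}

/-- [folklore] **FACTORISATION OF `R_φ`** (`N = M·Lc`, `M, Lc ≥ 1`; `ℓ = latticeSymbol N⁻¹ 0 q`, `q = qlab pr m`). -/
theorem rPhiTerm_factor (hLc : Lc ≠ 0) (hM : M ≠ 0) (hNM : N = M * Lc) (pr : Fin D → ℝ) (m : TorusSite D N) (κ l' : Fin D) (x' : Fin D → ℤ) :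
    (M : ℂ) ^ (D + 1) * rPhiTerm N M (ofRealVec pr) m κ l' x' =
      (N : ℂ) ^ (D + 4) * (cexp (I * ∑ i, ((qlab pr m i / Lc : ℝ) : ℂ) * (x' i : ℂ)) *
        ((∏ i, mfac N M (qlab pr m i)) *
          ((if κ = l' then mfac N M (qlab pr m κ) else 0) / (2 * ((latticeSymbol ((N : ℝ)⁻¹) 0 (qlab pr m) : ℝ) : ℂ)) -
            (cexp (I * ((qlab pr m κ / Lc : ℝ) : ℂ)) - 1) * (cexp (-(I * ((qlab pr m l' : ℝ) : ℂ))) - 1) /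
              (2 * ((latticeSymbol ((N : ℝ)⁻¹) 0 (qlab pr m) : ℝ) : ℂ) ^ 2)))) := by
  set ℓ : ℝ := latticeSymbol ((N : ℝ)⁻¹) 0 (qlab pr m) with hℓ
  have hN' : (N : ℂ) ≠ 0 := Nat.cast_ne_zero.2 (NeZero.ne N)
  have hM' : (M : ℂ) ≠ 0 := Nat.cast_ne_zero.2 hM
  have hL : LAl N (ofRealVec pr) m = (ℓ : ℂ) / (N : ℂ) ^ 2 := by rw [LAl_ofRealVec_eq, ← hℓ]; push_cast; ring
  rcases eq_or_ne ℓ 0 with hℓ0 | hℓ0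
  · have h0 : rPhiTerm N M (ofRealVec pr) m κ l' x' = 0 := by rw [rPhiTerm, hL, hℓ0]; simp
    rw [h0, hℓ0]; simp
  have hℓ' : (ℓ : ℂ) ≠ 0 := by exact_mod_cast hℓ0
  -- regroup (pure ring identity): readW·χ̂ = Ph·S_M S♭_N·s_{M,κ}/(M^{D+1}N^D); then pair s_{M,κ} with s♭_{l′} (δ) or with ∂_κ (P)
  have hcoef : ((if κ = l' then (1 : ℂ) else 0) - dAl N (ofRealVec pr) m κ * dbAl N (ofRealVec pr) m l' / LAl N (ofRealVec pr) m) *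
      sbAl N (ofRealVec pr) m l' / (2 * LAl N (ofRealVec pr) m) =
      (if κ = l' then (1 : ℂ) else 0) * sbAl N (ofRealVec pr) m l' * (N : ℂ) ^ 2 / (2 * ℓ) -
        dAl N (ofRealVec pr) m κ * (dbAl N (ofRealVec pr) m l' * sbAl N (ofRealVec pr) m l') * (N : ℂ) ^ 4 / (2 * (ℓ : ℂ) ^ 2) := by
    rw [hL]; field_simp
  have step : (M : ℂ) ^ (D + 1) * rPhiTerm N M (ofRealVec pr) m κ l' x' =
      cexp (I * ∑ i, kAl N (ofRealVec pr) m i * ((M : ℂ) * (x' i : ℂ))) * (SMAl N M (ofRealVec pr) m * SbAl N (ofRealVec pr) m) / (N : ℂ) ^ D *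
        ((if κ = l' then (1 : ℂ) else 0) * (N : ℂ) ^ 2 / (2 * ℓ) * (sMAl N M (ofRealVec pr) m κ * sbAl N (ofRealVec pr) m l') -
          (N : ℂ) ^ 4 / (2 * (ℓ : ℂ) ^ 2) * ((sMAl N M (ofRealVec pr) m κ * dAl N (ofRealVec pr) m κ) *
            (sbAl N (ofRealVec pr) m l' * dbAl N (ofRealVec pr) m l'))) := by
    rw [rPhiTerm, hcoef, readW, chiAl]
    set Ph := cexp (I * ∑ i, kAl N (ofRealVec pr) m i * ((M : ℂ) * (x' i : ℂ))) with hPh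
    field_simp
  rw [step, readPhase_eq hLc hNM, SMAl_mul_SbAl, sMAl_mul_dAl hLc hNM, sbAl_mul_dbAl]
  by_cases hκl : κ = l'
  · subst hκl
    rw [if_pos rfl, if_pos rfl, sMAl_mul_sbAl]
    field_simp
    ring
  · rw [if_neg hκl, if_neg hκl]
    field_simp
    ring

/-- [folklore] **FACTORISATION OF `R_c`**. -/
theorem rCTerm_factor (hLc : Lc ≠ 0) (hM : M ≠ 0) (hNM : N = M * Lc) (pr : Fin D → ℝ) (m : TorusSite D N) (κ : Fin D) (x' : Fin D → ℤ) :
    (M : ℂ) ^ (D + 1) * rCTerm N M (ofRealVec pr) m κ x' =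
      (N : ℂ) ^ (D + 4) * (cexp (I * ∑ i, ((qlab pr m i / Lc : ℝ) : ℂ) * (x' i : ℂ)) *
        ((∏ i, mfac N M (qlab pr m i)) * ((cexp (I * ((qlab pr m κ / Lc : ℝ) : ℂ)) - 1) /
          ((latticeSymbol ((N : ℝ)⁻¹) 0 (qlab pr m) : ℝ) : ℂ) ^ 2))) := by
  set ℓ : ℝ := latticeSymbol ((N : ℝ)⁻¹) 0 (qlab pr m) with hℓ
  have hN' : (N : ℂ) ≠ 0 := Nat.cast_ne_zero.2 (NeZero.ne N)
  have hM' : (M : ℂ) ≠ 0 := Nat.cast_ne_zero.2 hM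
  have hL : LAl N (ofRealVec pr) m = (ℓ : ℂ) / (N : ℂ) ^ 2 := by rw [LAl_ofRealVec_eq, ← hℓ]; push_cast; ring
  rcases eq_or_ne ℓ 0 with hℓ0 | hℓ0
  · have h0 : rCTerm N M (ofRealVec pr) m κ x' = 0 := by rw [rCTerm, hL, hℓ0]; simp
    rw [h0, hℓ0]; simp
  have hℓ' : (ℓ : ℂ) ≠ 0 := by exact_mod_cast hℓ0
  have step : (M : ℂ) ^ (D + 1) * rCTerm N M (ofRealVec pr) m κ x' =
      cexp (I * ∑ i, kAl N (ofRealVec pr) m i * ((M : ℂ) * (x' i : ℂ))) * (SMAl N M (ofRealVec pr) m * SbAl N (ofRealVec pr) m) / (N : ℂ) ^ D *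
        ((N : ℂ) ^ 4 / (ℓ : ℂ) ^ 2 * (sMAl N M (ofRealVec pr) m κ * dAl N (ofRealVec pr) m κ)) := by
    rw [rCTerm, hL, readW, chiAl]
    set Ph := cexp (I * ∑ i, kAl N (ofRealVec pr) m i * ((M : ℂ) * (x' i : ℂ))) with hPh
    field_simp
  rw [step, readPhase_eq hLc hNM, SMAl_mul_SbAl, sMAl_mul_dAl hLc hNM]
  field_simp
  ring

/-- [folklore] **FACTORISATION OF `S_φ`**. -/
theorem sPhiTerm_factor (hLc : Lc ≠ 0) (hM : M ≠ 0) (hNM : N = M * Lc) (pr : Fin D → ℝ) (m : TorusSite D N) (l' l : Fin D) (y' : Fin D → ℤ) :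
    (M : ℂ) ^ (D + 1) * sPhiTerm N M (ofRealVec pr) m l' l y' =
      -((N : ℂ) ^ (D + 4) * (cexp (-(I * ∑ i, ((qlab pr m i / Lc : ℝ) : ℂ) * (y' i : ℂ))) *
        ((∏ i, mfacS N M (qlab pr m i)) *
          ((if l' = l then mfacS N M (qlab pr m l) else 0) / (2 * ((latticeSymbol ((N : ℝ)⁻¹) 0 (qlab pr m) : ℝ) : ℂ)) -
            (cexp (I * ((qlab pr m l' : ℝ) : ℂ)) - 1) * (cexp (-(I * ((qlab pr m l / Lc : ℝ) : ℂ))) - 1) /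
              (2 * ((latticeSymbol ((N : ℝ)⁻¹) 0 (qlab pr m) : ℝ) : ℂ) ^ 2))))) := by
  set ℓ : ℝ := latticeSymbol ((N : ℝ)⁻¹) 0 (qlab pr m) with hℓ
  have hN' : (N : ℂ) ≠ 0 := Nat.cast_ne_zero.2 (NeZero.ne N)
  have hM' : (M : ℂ) ≠ 0 := Nat.cast_ne_zero.2 hM
  have hL : LAl N (ofRealVec pr) m = (ℓ : ℂ) / (N : ℂ) ^ 2 := by rw [LAl_ofRealVec_eq, ← hℓ]; push_cast; ring
  rcases eq_or_ne ℓ 0 with hℓ0 | hℓ0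
  · have h0 : sPhiTerm N M (ofRealVec pr) m l' l y' = 0 := by rw [sPhiTerm, hL, hℓ0]; simp
    rw [h0, hℓ0]; simp
  have hℓ' : (ℓ : ℂ) ≠ 0 := by exact_mod_cast hℓ0
  have hcoef : ((if l' = l then (1 : ℂ) else 0) - dAl N (ofRealVec pr) m l' * dbAl N (ofRealVec pr) m l / LAl N (ofRealVec pr) m) =
      (if l' = l then (1 : ℂ) else 0) - dAl N (ofRealVec pr) m l' * dbAl N (ofRealVec pr) m l * (N : ℂ) ^ 2 / ℓ := by
    rw [hL]; field_simp
  have step : (M : ℂ) ^ (D + 1) * sPhiTerm N M (ofRealVec pr) m l' l y' =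
      -(cexp (-(I * ∑ i, kAl N (ofRealVec pr) m i * ((M : ℂ) * (y' i : ℂ)))) * (SAl N (ofRealVec pr) m * SbMAl N M (ofRealVec pr) m) / (N : ℂ) ^ D *
        ((if l' = l then (1 : ℂ) else 0) * (N : ℂ) ^ 2 / (2 * ℓ) * (sAl N (ofRealVec pr) m l' * sbMAl N M (ofRealVec pr) m l) -
          (N : ℂ) ^ 4 / (2 * (ℓ : ℂ) ^ 2) * ((sAl N (ofRealVec pr) m l' * dAl N (ofRealVec pr) m l') *
            (sbMAl N M (ofRealVec pr) m l * dbAl N (ofRealVec pr) m l)))) := by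
    rw [sPhiTerm, hcoef, hL, srcW]
    set Ph := cexp (-(I * ∑ i, kAl N (ofRealVec pr) m i * ((M : ℂ) * (y' i : ℂ)))) with hPh
    field_simp
  rw [step, srcPhase_eq hLc hNM, SAl_mul_SbMAl, sAl_mul_dAl, sbMAl_mul_dbAl hLc hNM]
  by_cases hll : l' = l
  · subst hll
    rw [if_pos rfl, if_pos rfl, sAl_mul_sbMAl]
    field_simp
    ring
  · rw [if_neg hll, if_neg hll]
    field_simp
    ring

/-- [folklore] **FACTORISATION OF `S_c`**. -/
theorem sCTerm_factor (hLc : Lc ≠ 0) (hM : M ≠ 0) (hNM : N = M * Lc) (pr : Fin D → ℝ) (m : TorusSite D N) (l : Fin D) (y' : Fin D → ℤ) :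
    (M : ℂ) ^ (D + 1) * sCTerm N M (ofRealVec pr) m l y' =
      -((N : ℂ) ^ (D + 4) * (cexp (-(I * ∑ i, ((qlab pr m i / Lc : ℝ) : ℂ) * (y' i : ℂ))) *
        ((∏ i, mfacS N M (qlab pr m i)) * ((cexp (-(I * ((qlab pr m l / Lc : ℝ) : ℂ))) - 1) /
          ((latticeSymbol ((N : ℝ)⁻¹) 0 (qlab pr m) : ℝ) : ℂ) ^ 2)))) := by
  set ℓ : ℝ := latticeSymbol ((N : ℝ)⁻¹) 0 (qlab pr m) with hℓ
  have hN' : (N : ℂ) ≠ 0 := Nat.cast_ne_zero.2 (NeZero.ne N)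
  have hM' : (M : ℂ) ≠ 0 := Nat.cast_ne_zero.2 hM
  have hL : LAl N (ofRealVec pr) m = (ℓ : ℂ) / (N : ℂ) ^ 2 := by rw [LAl_ofRealVec_eq, ← hℓ]; push_cast; ring
  rcases eq_or_ne ℓ 0 with hℓ0 | hℓ0
  · have h0 : sCTerm N M (ofRealVec pr) m l y' = 0 := by rw [sCTerm, hL, hℓ0]; simp
    rw [h0, hℓ0]; simp
  have hℓ' : (ℓ : ℂ) ≠ 0 := by exact_mod_cast hℓ0
  have step : (M : ℂ) ^ (D + 1) * sCTerm N M (ofRealVec pr) m l y' =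
      -(cexp (-(I * ∑ i, kAl N (ofRealVec pr) m i * ((M : ℂ) * (y' i : ℂ)))) * (SAl N (ofRealVec pr) m * SbMAl N M (ofRealVec pr) m) / (N : ℂ) ^ D *
        ((N : ℂ) ^ 4 / (ℓ : ℂ) ^ 2 * (sbMAl N M (ofRealVec pr) m l * dbAl N (ofRealVec pr) m l))) := by
    rw [sCTerm, hL, srcW]
    set Ph := cexp (-(I * ∑ i, kAl N (ofRealVec pr) m i * ((M : ℂ) * (y' i : ℂ)))) with hPh
    field_simp
  rw [step, srcPhase_eq hLc hNM, SAl_mul_SbMAl, sbMAl_mul_dbAl hLc hNM]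
  field_simp
  ring

end Real

end Summit.QuantumFields.BalabanUV.Beta.GAN24.FibreRateFeedTerms

end
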